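import Mathlib.LinearAlgebra.Matrix.BilinearForm
import Mathlib.LinearAlgebra.BilinearForm.Orthogonal
import Mathlib.LinearAlgebra.LinearIndependent.BaseChange
import Mathlib.LinearAlgebra.FiniteDimensional.Lemmas
import Mathlib.Analysis.Complex.Basic
import Mathlib.Topology.Algebra.Order.Archimedean
import Mathlib.Topology.Instances.Rat
import HarnessLib

/-!
# Crux `WeilTwelvefoldsSqrtMinus7` (stmt-HodgeConjecture-1261), line `amnesic-secant-sheaves-split-fourteenfolds` — lemmas for stub `stub_weilSignatureOfModel` (α₂, r6), part I: rational linear algebra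

Helper file of the stub `stub_weilSignatureOfModel` (signature `(n, n)` of the rational degree-one model of a
polarized abelian variety of Weil type; B. van Geemen, LNM 1594 (1994), Lemma 5.2 (4)–(5)), the part that is
PURE LINEAR ALGEBRA over `ℚ ⊂ ℝ ⊂ ℂ` on coordinate vectors `ι → ℚ`, `ι → ℂ`. Data: rational matrices `M_A`
(`M_A² = -d`, the matrix of `φ^*` on `H¹`) and `G_A` (Gram matrix of the polarization pairing: alternating, of
Weil type `M_Aᵀ G_A M_A = d G_A`); then `S(x, y) = x ⬝ G_A (M_A y)` is SYMMETRIC, `M_A` is a similitude of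
multiplier `d`, `S(x, M_A x) = 0`, `S(a x + b M_A x) = (a² + d b²) S(x)` (`weilSig_*`).

* `weilSig_exists_mem_pos` — density step: a rational subspace `W` and a complex subspace `Z` with
  `Re (z ⬝ C z̄) > 0` on `Z ∖ 0` and `dim_ℚ W + dim_ℂ Z > |ι|` give `v ∈ W` with `v ⬝ C v > 0` (`W_ℂ ∩ Z ≠ 0`,
  rational vectors independent over `ℚ` being independent over `ℂ` — Mathlib's
  `linearIndependent_algebraMap_comp_iff`; `Re (z ⬝ C z̄) = a ⬝ C a + b ⬝ C b` for `z = a + ib`; density of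
  `ℚᵐ` in `ℝᵐ` and continuity of a quadratic polynomial);
* `weilSig_exists_stable_posDef` — van Geemen's inductive construction (proof of 5.2 (5), in coordinates)
  of an `M_A`-stable rational `2n`-dimensional `S`-positive subspace, one `K`-line `ℚ v + ℚ M_A v` at a time
  in `S`-orthogonal complements, granted a complex `Z`, `dim Z ≥ 2n`, with `Re S(z, z̄) > 0`;
  `weilSig_exists_PN` — both signs (shape `hPN` of `Theorems.exists_isotropic_blockVectors'`). All proved.
-/

noncomputable section

set_option linter.dupNamespace false

open Complex
open scoped Matrix

namespace Summit.HodgeConjecture.HodgeConjecture.Theorems.WeilTwelvefoldsSqrtMinus7.AmnesicSecantSheaves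

/-! ## Bilinear bookkeeping -/

/-- Expanding a bilinear map on two finite combinations of a family:
`B (Σ aᵢ uᵢ) (Σ cⱼ uⱼ) = Σᵢ Σⱼ (aᵢ cⱼ) • B uᵢ uⱼ` (any commutative semiring). [folklore] -/
theorem weilSig_bilin_sum_sum {R V W κ : Type*} [CommSemiring R] [AddCommMonoid V] [Module R V]
    [AddCommMonoid W] [Module R W] [Fintype κ] (B : V →ₗ[R] V →ₗ[R] W) (a c : κ → R) (u : κ → V) :
    B (∑ i, a i • u i) (∑ j, c j • u j) = ∑ i, ∑ j, (a i * c j) • B (u i) (u j) := by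
  have h1 : ∀ j, B (∑ i, a i • u i) (c j • u j) = ∑ i, (a i * c j) • B (u i) (u j) := by
    intro j
    rw [LinearMap.map_smul, map_sum, LinearMap.sum_apply, Finset.smul_sum]
    refine Finset.sum_congr rfl fun i _ => ?_
    rw [LinearMap.map_smul, LinearMap.smul_apply, smul_smul, mul_comm]
  rw [map_sum]
  simp_rw [h1]
  rw [Finset.sum_comm]

variable {ι : Type*} [Fintype ι] [DecidableEq ι]

/-! ## The density step -/

/-- **Density step.** For a rational matrix `C`, a rational subspace `W ⊆ ℚ^ι` and a complex subspace
`Z ⊆ ℂ^ι` with `Re (z ⬝ C z̄) > 0` on `Z ∖ 0` and `dim_ℚ W + dim_ℂ Z > |ι|`, some `v ∈ W` has `v ⬝ C v > 0`: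
a `ℚ`-basis `(wₖ)` of `W` is `ℂ`-independent, so its complex span meets `Z` in some `z = Σ cₖ wₖ ≠ 0`; with
`F(r) = Σₖₗ rₖ rₗ (wₖ ⬝ C wₗ)`, `Re (z ⬝ C z̄) = F(Re c) + F(Im c) > 0`, so `F > 0` at a real, hence (continuity,
density) at a rational point `q`, and `v = Σ qₖ wₖ`. [cite: vanGeemen1994HodgeAV, proof of Lemma 5.2 (5)] -/
theorem weilSig_exists_mem_pos (C : Matrix ι ι ℚ) (W : Submodule ℚ (ι → ℚ))
    (Z : Submodule ℂ (ι → ℂ)) (hdim : Fintype.card ι < Module.finrank ℚ W + Module.finrank ℂ Z)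
    (hpos : ∀ z ∈ Z, z ≠ 0 → 0 < (z ⬝ᵥ C.map (algebraMap ℚ ℂ) *ᵥ star z).re) :
    ∃ v ∈ W, 0 < v ⬝ᵥ C *ᵥ v := by
  classical
  set m := Module.finrank ℚ W with hm
  let bW := Module.finBasis ℚ W
  let w : Fin m → ι → ℚ := fun k => (bW k : ι → ℚ)
  have hw : LinearIndependent ℚ w :=
    bW.linearIndependent.map' W.subtype (Submodule.ker_subtype W)
  let wc : Fin m → ι → ℂ := fun k => algebraMap ℚ ℂ ∘ w k
  have hwc : LinearIndependent ℂ wc := linearIndependent_algebraMap_comp_iff.2 hw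
  set Wc : Submodule ℂ (ι → ℂ) := Submodule.span ℂ (Set.range wc) with hWc_def
  have hWc : Module.finrank ℂ Wc = m := by
    rw [hWc_def, finrank_span_eq_card hwc, Fintype.card_fin]
  obtain ⟨z, hzW, hzZ, hz0⟩ : ∃ z, z ∈ Wc ∧ z ∈ Z ∧ z ≠ 0 := by
    by_contra hcon
    have hdis : Disjoint Wc Z := by
      rw [Submodule.disjoint_def]
      intro z hzW hzZ
      by_contra hz0
      exact hcon ⟨z, hzW, hzZ, hz0⟩
    have h := Submodule.finrank_add_finrank_le_of_disjoint hdis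
    rw [hWc, Module.finrank_fintype_fun_eq_card] at h
    omega
  obtain ⟨c, rfl⟩ := (Submodule.mem_span_range_iff_exists_fun ℂ).1 hzW
  let q : Fin m → Fin m → ℚ := fun k l => w k ⬝ᵥ C *ᵥ w l
  let F : (Fin m → ℝ) → ℝ := fun r => ∑ k, ∑ l, r k * r l * (q k l : ℝ)
  have hF : Continuous F :=
    continuous_finsetSum _ fun k _ => continuous_finsetSum _ fun l _ =>
      ((continuous_apply k).mul (continuous_apply l)).mul continuous_const
  -- `Re (z ⬝ C z̄) = F(Re c) + F(Im c)`
  have hstar : star (∑ k, c k • wc k) = ∑ k, (starRingEnd ℂ) (c k) • wc k := by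
    rw [star_sum]
    refine Finset.sum_congr rfl fun k _ => ?_
    rw [star_smul]
    congr 1
    funext i
    exact map_ratCast (starRingEnd ℂ) (w k i)
  have hpair : ∀ k l, wc k ⬝ᵥ C.map (algebraMap ℚ ℂ) *ᵥ wc l = ((q k l : ℚ) : ℂ) := fun k l => by
    rw [show C.map (algebraMap ℚ ℂ) *ᵥ wc l = algebraMap ℚ ℂ ∘ (C *ᵥ w l) from
      funext fun i => (RingHom.map_mulVec (algebraMap ℚ ℂ) C (w l) i).symm, ← RingHom.map_dotProduct]
    rfl
  have hexp : (∑ k, c k • wc k) ⬝ᵥ C.map (algebraMap ℚ ℂ) *ᵥ star (∑ k, c k • wc k) =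
      ∑ k, ∑ l, (c k * (starRingEnd ℂ) (c l)) * ((q k l : ℚ) : ℂ) := by
    rw [hstar, ← Matrix.toBilin'_apply', weilSig_bilin_sum_sum]
    refine Finset.sum_congr rfl fun k _ => Finset.sum_congr rfl fun l _ => ?_
    rw [Matrix.toBilin'_apply', hpair, smul_eq_mul]
  have hre : ((∑ k, c k • wc k) ⬝ᵥ C.map (algebraMap ℚ ℂ) *ᵥ star (∑ k, c k • wc k)).re =
      F (fun k => (c k).re) + F (fun k => (c k).im) := by
    rw [hexp, Complex.re_sum]
    simp only [Complex.re_sum, Complex.mul_re, Complex.mul_im, Complex.conj_re, Complex.conj_im,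
      Complex.ratCast_re, Complex.ratCast_im, mul_zero, sub_zero, F]
    rw [← Finset.sum_add_distrib]
    refine Finset.sum_congr rfl fun k _ => ?_
    rw [← Finset.sum_add_distrib]
    refine Finset.sum_congr rfl fun l _ => ?_
    ring
  obtain ⟨r, hr⟩ : ∃ r, 0 < F r := by
    by_contra hno
    push Not at hno
    linarith [hno (fun k => (c k).re), hno (fun k => (c k).im), (hre ▸ hpos _ hzZ hz0 :)]
  obtain ⟨qv, hqv⟩ := (DenseRange.piMap fun _ : Fin m => Rat.denseRange_cast (𝕜 := ℝ)).exists_mem_open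
    (isOpen_lt continuous_const hF) ⟨r, hr⟩
  refine ⟨∑ k, qv k • w k, Submodule.sum_mem _ fun k _ => Submodule.smul_mem _ _ (bW k).2, ?_⟩
  have hval : (((∑ k, qv k • w k) ⬝ᵥ C *ᵥ (∑ k, qv k • w k) : ℚ) : ℝ) =
      F (Pi.map (fun _ : Fin m => ((↑) : ℚ → ℝ)) qv) := by
    rw [← Matrix.toBilin'_apply', weilSig_bilin_sum_sum]
    simp only [Matrix.toBilin'_apply', smul_eq_mul, Rat.cast_sum, Rat.cast_mul, F, q, Pi.map_apply]
  have h : (0 : ℝ) < ((∑ k, qv k • w k) ⬝ᵥ C *ᵥ (∑ k, qv k • w k) : ℚ) := by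
    rw [hval]
    exact hqv
  exact_mod_cast h

/-! ## The symmetric rational form `S(x, y) = x ⬝ G_A (M_A y)` of a Weil pair -/

section WeilPair

variable {d : ℚ} {MA GA : Matrix ι ι ℚ}

/-- `M_Aᵀ G_A = -G_A M_A` (from `M_A² = -d`, `M_Aᵀ G_A M_A = d G_A`, `d ≠ 0`). [folklore] -/
theorem weilSig_transpose_mul (hd : d ≠ 0) (hMA : MA * MA = (-d) • (1 : Matrix ι ι ℚ))
    (hWt : MAᵀ * GA * MA = d • GA) : MAᵀ * GA = -(GA * MA) := by
  have h : MAᵀ * GA * MA * MA = d • (GA * MA) := by rw [hWt, Matrix.smul_mul]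
  rw [Matrix.mul_assoc, hMA, Matrix.mul_smul, Matrix.mul_one] at h
  have h2 : d • (MAᵀ * GA + GA * MA) = 0 := by
    rw [smul_add, ← h, neg_smul, add_neg_cancel]
  rcases smul_eq_zero.1 h2 with h3 | h3
  · exact absurd h3 hd
  · exact eq_neg_of_add_eq_zero_left h3

/-- **`S` is symmetric**: `(G_A M_A)ᵀ = G_A M_A` for `G_A` alternating of Weil type.
[cite: vanGeemen1994HodgeAV, Lemma 5.2 (2)] -/
theorem weilSig_isSymm (hd : d ≠ 0) (hMA : MA * MA = (-d) • (1 : Matrix ι ι ℚ)) (hGA : GAᵀ = -GA)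
    (hWt : MAᵀ * GA * MA = d • GA) : (GA * MA).IsSymm := by
  change (GA * MA)ᵀ = GA * MA
  rw [Matrix.transpose_mul, hGA, Matrix.mul_neg, weilSig_transpose_mul hd hMA hWt, neg_neg]

/-- `S(x, y) = x ⬝ G_A (M_A y)` is the bilinear form of the matrix `G_A M_A`. [folklore] -/
theorem weilSig_apply (x y : ι → ℚ) : Matrix.toBilin' (GA * MA) x y = x ⬝ᵥ GA *ᵥ (MA *ᵥ y) := by
  rw [Matrix.toBilin'_apply', Matrix.mulVec_mulVec]

/-- `S(x, y) = S(y, x)`. [cite: vanGeemen1994HodgeAV, Lemma 5.2 (2)] -/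
theorem weilSig_comm (hd : d ≠ 0) (hMA : MA * MA = (-d) • (1 : Matrix ι ι ℚ)) (hGA : GAᵀ = -GA)
    (hWt : MAᵀ * GA * MA = d • GA) (x y : ι → ℚ) :
    x ⬝ᵥ GA *ᵥ (MA *ᵥ y) = y ⬝ᵥ GA *ᵥ (MA *ᵥ x) := by
  rw [← weilSig_apply, ← weilSig_apply]
  exact (Matrix.isSymm_toBilin'_iff_isSymm.2 (weilSig_isSymm hd hMA hGA hWt)).eq x y

/-- **`M_A` is a similitude of `S`**: `S(M_A x, M_A y) = d · S(x, y)`. [cite: vanGeemen1994HodgeAV, Lemma 5.2 (2)] -/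
theorem weilSig_mulVec_mulVec (hWt : MAᵀ * GA * MA = d • GA) (x y : ι → ℚ) :
    MA *ᵥ x ⬝ᵥ GA *ᵥ (MA *ᵥ (MA *ᵥ y)) = d * (x ⬝ᵥ GA *ᵥ (MA *ᵥ y)) := by
  have h := Matrix.toBilin'_comp (GA * MA) MA MA
  rw [show MAᵀ * (GA * MA) * MA = d • (GA * MA) by rw [← Matrix.mul_assoc, hWt, Matrix.smul_mul],
    map_smul] at h
  have h' := congrArg (fun B : LinearMap.BilinForm ℚ (ι → ℚ) => B x y) h
  simp only [LinearMap.BilinForm.comp_apply, Matrix.toLin'_apply, LinearMap.smul_apply,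
    smul_eq_mul] at h'
  rw [weilSig_apply, weilSig_apply] at h'
  exact h'

/-- `S(x, M_A x) = 0` (`= -d · x ⬝ G_A x`, and `x ⬝ G_A x = 0` as `G_A` is alternating).
[cite: vanGeemen1994HodgeAV, Lemma 5.2 (2)] -/
theorem weilSig_self_mulVec (hMA : MA * MA = (-d) • (1 : Matrix ι ι ℚ)) (hGA : GAᵀ = -GA)
    (x : ι → ℚ) : x ⬝ᵥ GA *ᵥ (MA *ᵥ (MA *ᵥ x)) = 0 := by
  have h : x ⬝ᵥ GA *ᵥ x = -(x ⬝ᵥ GA *ᵥ x) := by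
    conv_lhs => rw [Matrix.dotProduct_mulVec, ← Matrix.mulVec_transpose, hGA, Matrix.neg_mulVec,
      neg_dotProduct, dotProduct_comm]
  rw [Matrix.mulVec_mulVec x MA MA, hMA, Matrix.smul_mulVec, Matrix.one_mulVec, Matrix.mulVec_smul,
    dotProduct_smul, show x ⬝ᵥ GA *ᵥ x = 0 by linarith, smul_zero]

/-- `S(a x + b M_A x, a x + b M_A x) = (a² + d b²) S(x, x)`: a `K`-line `ℚ x + ℚ M_A x` is
`S`-definite of the sign of `S(x, x)`. [cite: vanGeemen1994HodgeAV, proof of Lemma 5.2 (5)] -/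
theorem weilSig_line (hd : d ≠ 0) (hMA : MA * MA = (-d) • (1 : Matrix ι ι ℚ)) (hGA : GAᵀ = -GA)
    (hWt : MAᵀ * GA * MA = d • GA) (x : ι → ℚ) (a b : ℚ) :
    (a • x + b • MA *ᵥ x) ⬝ᵥ GA *ᵥ (MA *ᵥ (a • x + b • MA *ᵥ x)) =
      (a ^ 2 + d * b ^ 2) * (x ⬝ᵥ GA *ᵥ (MA *ᵥ x)) := by
  have h1 := weilSig_self_mulVec hMA hGA x
  have h2 : MA *ᵥ x ⬝ᵥ GA *ᵥ (MA *ᵥ x) = 0 := by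
    rw [← weilSig_comm hd hMA hGA hWt, h1]
  have h3 := weilSig_mulVec_mulVec hWt x x
  simp only [Matrix.mulVec_add, Matrix.mulVec_smul, dotProduct_add, dotProduct_smul, add_dotProduct,
    smul_dotProduct, smul_eq_mul, h1, h2, h3]
  ring

/-! ## The inductive construction of a definite `M_A`-stable rational subspace -/

/-- **A positive definite `M_A`-stable rational subspace of dimension `2n`** (van Geemen 1994, proof of
Lemma 5.2 (5), in coordinates): for `d > 0`, `M_A² = -d`, `G_A` alternating with `M_Aᵀ G_A M_A = d G_A`,
and a complex subspace `Z ⊆ ℂ^ι`, `dim Z ≥ 2n`, with `Re (z ⬝ G_A M_A z̄) > 0` on `Z ∖ 0`, there is an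
`M_A`-stable `ℚ`-subspace `P ⊆ ℚ^ι` of dimension `2n` with `x ⬝ G_A (M_A x) > 0` on `P ∖ 0`. Induction on
`j ≤ n`: the `S`-orthogonal `W` of `P_j` (`dim P_j = 2j`) has `dim W ≥ |ι| - 2j`, the density step gives
`v ∈ W` with `S(v, v) > 0`, `W` is `M_A`-stable, `v, M_A v` are independent (`c² = -d` has no rational root),
and `P_{j+1} = P_j ⊕ (ℚ v + ℚ M_A v)` is positive definite (`S(a v + b M_A v) = (a² + d b²) S(v)`).
[cite: vanGeemen1994HodgeAV, Lemma 5.2 (4)–(5)] -/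
theorem weilSig_exists_stable_posDef (hd : 0 < d) (hMA : MA * MA = (-d) • (1 : Matrix ι ι ℚ))
    (hGA : GAᵀ = -GA) (hWt : MAᵀ * GA * MA = d • GA) (n : ℕ) (Z : Submodule ℂ (ι → ℂ))
    (hZ : 2 * n ≤ Module.finrank ℂ Z)
    (hpos : ∀ z ∈ Z, z ≠ 0 → 0 < (z ⬝ᵥ (GA * MA).map (algebraMap ℚ ℂ) *ᵥ star z).re) :
    ∃ P : Submodule ℚ (ι → ℚ), (∀ v ∈ P, MA *ᵥ v ∈ P) ∧ Module.finrank ℚ P = 2 * n ∧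
      ∀ x ∈ P, x ≠ 0 → 0 < x ⬝ᵥ GA *ᵥ (MA *ᵥ x) := by
  classical
  have hd0 : d ≠ 0 := hd.ne'
  suffices key : ∀ j ≤ n, ∃ P : Submodule ℚ (ι → ℚ), (∀ v ∈ P, MA *ᵥ v ∈ P) ∧
      Module.finrank ℚ P = 2 * j ∧ ∀ x ∈ P, x ≠ 0 → 0 < x ⬝ᵥ GA *ᵥ (MA *ᵥ x) from key n le_rfl
  intro j
  induction j with
  | zero =>
    exact fun _ => ⟨⊥, fun v hv => by rw [(Submodule.mem_bot ℚ).1 hv, Matrix.mulVec_zero]; exact zero_mem _,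
      finrank_bot ℚ _, fun x hx hx0 => absurd ((Submodule.mem_bot ℚ).1 hx) hx0⟩
  | succ j ih =>
    intro hj
    obtain ⟨P, hPst, hPf, hPpos⟩ := ih (Nat.le_of_succ_le hj)
    set S : LinearMap.BilinForm ℚ (ι → ℚ) := Matrix.toBilin' (GA * MA) with hS_def
    have hS : ∀ x y, S x y = x ⬝ᵥ GA *ᵥ (MA *ᵥ y) := fun x y => weilSig_apply x y
    have hSsymm : S.IsSymm := Matrix.isSymm_toBilin'_iff_isSymm.2 (weilSig_isSymm hd0 hMA hGA hWt)
    set W := S.orthogonal P with hW_def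
    have hWmem : ∀ v, v ∈ W ↔ ∀ p ∈ P, p ⬝ᵥ GA *ᵥ (MA *ᵥ v) = 0 := fun v => by
      rw [hW_def, LinearMap.BilinForm.mem_orthogonal_iff]
      simp only [hS]
    -- `dim W ≥ |ι| - 2j`
    have hWdim : Fintype.card ι ≤ Module.finrank ℚ W + 2 * j := by
      have h := LinearMap.BilinForm.finrank_add_finrank_orthogonal hSsymm.isRefl P
      rw [← hW_def, Module.finrank_fintype_fun_eq_card, hPf] at h
      omega
    obtain ⟨v, hvW, hvpos⟩ := weilSig_exists_mem_pos (GA * MA) W Z (by omega) hpos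
    rw [← Matrix.mulVec_mulVec] at hvpos
    have hv0 : v ≠ 0 := by
      rintro rfl
      simp at hvpos
    -- `W` is `M_A`-stable
    have hWst : ∀ x ∈ W, MA *ᵥ x ∈ W := by
      intro x hx
      rw [hWmem] at hx ⊢
      intro p hp
      have hp' : (-(1 / d)) • MA *ᵥ p ∈ P := Submodule.smul_mem _ _ (hPst p hp)
      have e : MA *ᵥ ((-(1 / d)) • MA *ᵥ p) = p := by
        rw [Matrix.mulVec_smul, Matrix.mulVec_mulVec, hMA, Matrix.smul_mulVec, Matrix.one_mulVec,
          smul_smul]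
        rw [show -(1 / d) * -d = 1 by field_simp, one_smul]
      rw [← e, weilSig_mulVec_mulVec hWt, hx _ hp', mul_zero]
    set L : Submodule ℚ (ι → ℚ) := Submodule.span ℚ {v, MA *ᵥ v} with hL_def
    have hLW : L ≤ W := by
      rw [hL_def, Submodule.span_le]
      intro x hx
      rcases hx with rfl | rfl
      · exact hvW
      · exact hWst _ hvW
    have hLmem : ∀ x, x ∈ L ↔ ∃ a b : ℚ, a • v + b • MA *ᵥ v = x := fun x => Submodule.mem_span_pair
    -- `v, M_A v` independent, `dim L = 2`
    have hind : LinearIndependent ℚ ![v, MA *ᵥ v] := by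
      rw [LinearIndependent.pair_iff]
      intro s t hst
      have h2 : MA *ᵥ (s • v + t • MA *ᵥ v) = 0 := by rw [hst, Matrix.mulVec_zero]
      rw [Matrix.mulVec_add, Matrix.mulVec_smul, Matrix.mulVec_smul, Matrix.mulVec_mulVec, hMA,
        Matrix.smul_mulVec, Matrix.one_mulVec] at h2
      have h3 : (s * s + d * (t * t)) • v = 0 := by
        have e1 : s • (s • v + t • MA *ᵥ v) - t • (s • MA *ᵥ v + t • (-d) • v) =
            (s * s + d * (t * t)) • v := by
          simp only [smul_add, smul_smul, add_smul]
          module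
        rw [← e1, hst, h2, smul_zero, smul_zero, sub_zero]
      rcases smul_eq_zero.1 h3 with h4 | h4
      · have hs : s = 0 := by nlinarith [mul_self_nonneg s, mul_self_nonneg t]
        have ht : t * t = 0 := by nlinarith [mul_self_nonneg s, mul_self_nonneg t]
        exact ⟨hs, mul_self_eq_zero.1 ht⟩
      · exact absurd h4 hv0
    have hLf : Module.finrank ℚ L = 2 := by
      have e : L = Submodule.span ℚ (Set.range ![v, MA *ᵥ v]) := by
        rw [hL_def, Matrix.range_cons, Matrix.range_cons, Matrix.range_empty, Set.union_empty,
          Set.singleton_union]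
      rw [e, finrank_span_eq_card hind, Fintype.card_fin]
    -- `P ⊓ L = ⊥`
    have hPL : P ⊓ L = ⊥ := by
      rw [Submodule.eq_bot_iff]
      rintro x ⟨hxP, hxL⟩
      by_contra hx0
      have h1 := hPpos x hxP hx0
      have h2 : x ⬝ᵥ GA *ᵥ (MA *ᵥ x) = 0 := (hWmem x).1 (hLW hxL) x hxP
      rw [h2] at h1
      exact lt_irrefl _ h1
    refine ⟨P ⊔ L, ?_, ?_, ?_⟩
    · -- `M_A`-stability
      intro x hx
      obtain ⟨p, hp, l, hl, rfl⟩ := Submodule.mem_sup.1 hx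
      obtain ⟨a, b, rfl⟩ := (hLmem l).1 hl
      rw [Matrix.mulVec_add]
      refine Submodule.add_mem _ (Submodule.mem_sup_left (hPst p hp)) (Submodule.mem_sup_right ?_)
      rw [hLmem]
      refine ⟨b * -d, a, ?_⟩
      rw [Matrix.mulVec_add, Matrix.mulVec_smul, Matrix.mulVec_smul, Matrix.mulVec_mulVec, hMA,
        Matrix.smul_mulVec, Matrix.one_mulVec, smul_smul, add_comm]
    · -- dimension
      have h := Submodule.finrank_sup_add_finrank_inf_eq P L
      rw [hPL, finrank_bot, add_zero, hPf, hLf] at h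
      omega
    · -- positivity
      intro x hx hx0
      obtain ⟨p, hp, l, hl, rfl⟩ := Submodule.mem_sup.1 hx
      have hlW : l ∈ W := hLW hl
      have hcross1 : p ⬝ᵥ GA *ᵥ (MA *ᵥ l) = 0 := (hWmem _).1 hlW p hp
      have hcross2 : l ⬝ᵥ GA *ᵥ (MA *ᵥ p) = 0 := by
        rw [weilSig_comm hd0 hMA hGA hWt, hcross1]
      have e : (p + l) ⬝ᵥ GA *ᵥ (MA *ᵥ (p + l)) =
          p ⬝ᵥ GA *ᵥ (MA *ᵥ p) + l ⬝ᵥ GA *ᵥ (MA *ᵥ l) := by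
        rw [Matrix.mulVec_add, Matrix.mulVec_add, dotProduct_add, add_dotProduct, add_dotProduct, hcross1,
          hcross2]
        ring
      obtain ⟨a, b, hab⟩ := (hLmem l).1 hl
      have hsq : l ⬝ᵥ GA *ᵥ (MA *ᵥ l) = (a ^ 2 + d * b ^ 2) * (v ⬝ᵥ GA *ᵥ (MA *ᵥ v)) := by
        rw [← hab]
        exact weilSig_line hd0 hMA hGA hWt v a b
      rw [e, hsq]
      by_cases hp0 : p = 0
      · subst hp0
        rw [Matrix.mulVec_zero, Matrix.mulVec_zero, dotProduct_zero, zero_add]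
        have hab0 : a ≠ 0 ∨ b ≠ 0 := by
          by_contra h0
          push Not at h0
          apply hx0
          rw [← hab, h0.1, h0.2, zero_smul, zero_smul, add_zero, add_zero]
        have hq : 0 < a ^ 2 + d * b ^ 2 := by
          rcases hab0 with ha | hb
          · have : 0 < a ^ 2 := by positivity
            nlinarith [sq_nonneg b]
          · have : 0 < b ^ 2 := by positivity
            nlinarith [sq_nonneg a]
        exact mul_pos hq hvpos
      · have h1 := hPpos p hp hp0
        have h2 : 0 ≤ (a ^ 2 + d * b ^ 2) * (v ⬝ᵥ GA *ᵥ (MA *ᵥ v)) :=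
          mul_nonneg (by positivity) hvpos.le
        linarith

end WeilPair

/-- **Both signs at once, in the shape `hPN` of `Theorems.exists_isotropic_blockVectors'`**: complex
subspaces `Z₊`, `Z₋ ⊆ ℂ^ι` of dimension `≥ 2n` on which `Re S(z, z̄)` is positive, resp. negative, give
`M_A`-stable rational `P`, `N ⊆ ℚ^ι` of dimension `2n`, `S > 0` on `P ∖ 0`, `S < 0` on `N ∖ 0`, `P ⊓ N = 0`
(definiteness). [cite: vanGeemen1994HodgeAV, Lemma 5.2 (4)–(5)] -/
theorem weilSig_exists_PN {ι : Type*} [Fintype ι] [DecidableEq ι] {d : ℚ} {MA GA : Matrix ι ι ℚ}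
    (hd : 0 < d) (hMA : MA * MA = (-d) • (1 : Matrix ι ι ℚ)) (hGA : GA.transpose = -GA)
    (hWt : MA.transpose * GA * MA = d • GA) (n : ℕ) (Zp Zn : Submodule ℂ (ι → ℂ))
    (hZp : 2 * n ≤ Module.finrank ℂ Zp) (hZn : 2 * n ≤ Module.finrank ℂ Zn)
    (hpos : ∀ z ∈ Zp, z ≠ 0 → 0 < (z ⬝ᵥ ((GA * MA).map (algebraMap ℚ ℂ)).mulVec (star z)).re)
    (hneg : ∀ z ∈ Zn, z ≠ 0 → (z ⬝ᵥ ((GA * MA).map (algebraMap ℚ ℂ)).mulVec (star z)).re < 0) :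
    ∃ P N : Submodule ℚ (ι → ℚ), (∀ v ∈ P, MA.mulVec v ∈ P) ∧ (∀ v ∈ N, MA.mulVec v ∈ N) ∧
      Module.finrank ℚ P = 2 * n ∧ Module.finrank ℚ N = 2 * n ∧ P ⊓ N = ⊥ ∧
      (∀ x ∈ P, x ≠ 0 → 0 < x ⬝ᵥ GA.mulVec (MA.mulVec x)) ∧
      (∀ x ∈ N, x ≠ 0 → x ⬝ᵥ GA.mulVec (MA.mulVec x) < 0) := by
  obtain ⟨P, hPst, hPf, hPpos⟩ := weilSig_exists_stable_posDef hd hMA hGA hWt n Zp hZp hpos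
  -- the negative side: the positive side for `-G_A`
  have hGA' : (-GA)ᵀ = -(-GA) := by rw [Matrix.transpose_neg, hGA]
  have hWt' : MAᵀ * (-GA) * MA = d • (-GA) := by rw [Matrix.mul_neg, Matrix.neg_mul, hWt, smul_neg]
  have hpos' : ∀ z ∈ Zn, z ≠ 0 → 0 < (z ⬝ᵥ (-GA * MA).map (algebraMap ℚ ℂ) *ᵥ star z).re := by
    intro z hz hz0
    have h := hneg z hz hz0
    rw [Matrix.neg_mul, Matrix.map_neg _ (map_neg (algebraMap ℚ ℂ)), Matrix.neg_mulVec, dotProduct_neg,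
      Complex.neg_re]
    linarith
  obtain ⟨N, hNst, hNf, hNpos⟩ := weilSig_exists_stable_posDef hd hMA hGA' hWt' n Zn hZn hpos'
  have hNneg : ∀ x ∈ N, x ≠ 0 → x ⬝ᵥ GA *ᵥ (MA *ᵥ x) < 0 := fun x hx hx0 => by
    have h := hNpos x hx hx0
    rw [Matrix.neg_mulVec, dotProduct_neg] at h
    linarith
  refine ⟨P, N, hPst, hNst, hPf, hNf, ?_, hPpos, hNneg⟩
  rw [Submodule.eq_bot_iff]
  rintro x ⟨hxP, hxN⟩
  by_contra hx0
  exact lt_asymm (hPpos x hxP hx0) (hNneg x hxN hx0)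


end Summit.HodgeConjecture.HodgeConjecture.Theorems.WeilTwelvefoldsSqrtMinus7.AmnesicSecantSheaves

end
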